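import Summits.CriticalPhenomena.PercolationContinuityZ3.Theorems.PercNearOneGluingNoHeavyQuantIncomeCriterion
import Summits.CriticalPhenomena.PercolationContinuityZ3.Theorems.PercNearOneGluingNoHeavyQuantGateMoveBlobCellsZero
import Summits.CriticalPhenomena.PercolationContinuityZ3.Theorems.PercNearOneGluingNoHeavyQuantGateMoveBlobCells
import Summits.CriticalPhenomena.PercolationContinuityZ3.Theorems.PercNearOneGluingNoHeavyQuantSliceHeavy
import Summits.CriticalPhenomena.PercolationContinuityZ3.Theorems.PercNearOneGluingNoHeavyQuantGatedSliceWindow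
import HarnessLib

/-!
# QUANT lane R8, T-DEC, leg (III), blob case — `LawDec.GatedSliceMixLaw'`, the Q-ALONE side in REGIME R: the explicit ROUTING THEOREM for
# `Q = zδ₀ + (1−z)·slice {k₁,k₂;λ} a g` in the DEEP-SHIFTED-COPY classes `L×{m,M,G}` (BOTH copies `k₁` and `k₁ + a` are `t`-lows; the top
# `k₂` is a mid or a giant, the shifted top `k₂ + a` a giant) — ship the two lows into the top and the shifted top, the zero fits the leftovers

builds on p205010 (kernel theorem, internal audit signed; external expert review pending)

Support file (`--supports stmt-CriticalPhenomena-4575`), QUANT lane seat prim-quant-arm-1 (gen 41), rung R8 of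
`run/shared/lean/prim/quant/LADDER.md`.  Theorems only, standard axioms, no sorries, no definitions.  Companion of `…QuantGatedSliceMixLawQRouting`
(this seat: the single-nonzero-low classes `{m,M,G}×{m,M,G}`), `…QuantGatedSliceMixLawQAlone` (cells (Q1), (Q2′)), `…QuantGatedSliceMixLawPrime`
(typer g29: the node) and `…QuantIncomeCriterion` (arm-1 g39: `flowAtT_of_offers`).

THE SETTING.  Frame of the node (`0 < y < 1`, `0 ≤ z < 1`, `g ≤ 1`, `y ≤ (1−z)g`, `1 ≤ a`, `y·M ≤ S`, `(1−z)(k₁ + (k₂−k₁)λ) = S`,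
`t = S + ag(1−z)`), `Q = z·δ₀ + A·δ_{k₁} + B·δ_{k₁+a} + C·δ_{k₂} + D·δ_{k₂+a}` (`A = (1−z)(1−λ)(1−g)`, `B = (1−z)(1−λ)g`, `C = (1−z)λ(1−g)`,
`D = (1−z)λg`).  Here `1 ≤ k₁`, the shifted copy `k₁ + a` is ALSO a `t`-low (`k₁ + a ≤ j`, `2(k₁+a) < t`; then so is `k₁`), the top `K = k₂` is
not (`t ≤ 2k₂ ∨ j < k₂`), and `G = k₂ + a ≥ j+1`.  These are the classes `LG`, `LM`, `Lm` of this seat's census — where ALL the genuine mixtures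
of the node live (lead N121, typer g30) and where `Q` alone is DEC exactly when the routing below exists (exact census `work/explore/qroute.py`:
the mids-first split certifies every DEC instance; `LG`: DEC iff `y ≤ (1−z)λ`).

THE THEOREM (`mixLawQ_decAtT_of_routing_deep`).  Amounts `x₁K + x₁G = A` (the low `k₁` into `K` and `G`) and `x₂K + x₂G = B` (the low `k₁+a`
into `K` and `G`), nonnegative, used only on compatible absorbers (`x₁K > 0 ⟹ j+1 ≤ K ∨ t < k₁ + K`; `x₂K > 0 ⟹ j+1 ≤ K ∨ t < (k₁+a) + K`), within
capacity (`usage(k₁,K)x₁K + usage(k₁+a,K)x₂K ≤ C`, `usage(k₁,G)x₁G + usage(k₁+a,G)x₂G ≤ D`), and the zero fits the priced leftovers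
(`t·z ≤ κ(K)(C − load K) + t(1−y)/y·(D − load G)`, `κ` as in `flowAtT_of_offers`) ⟹ `Q` is `DECAtT y t j (M+a)`; node corollary with `θ = 0`
(`gatedSliceMixLaw'_of_routing_deep`).
HONEST STATUS: `GatedSliceMixLaw'` (regime R), CW, `GateMove`, `GatedConvEmptyFree`, `SingleGateConvClosed`, `TreeDEC`, `FarTreeRow` OPEN;
RATE class log\* / honest sentence of `run/shared/lean/prim/quant/README.md` unchanged.

[this work]; offers criterion: prim-quant-arm-1 g39; flow form: prim-quant-stmt g22–g26; node: prim-quant-stmt g29 (this lane).  Nothing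
here is cited as a published result.  The gluing rows served [cite: KozmaNitzan2024, Conjecture 3 (p. 15)]; product measure
[cite: Grimmett1999, §1.3 p. 10].
-/

noncomputable section

namespace Summit.CriticalPhenomena.PercolationContinuityZ3.Theorems

namespace Quant

open Finset

/-- the two-point law `{lo, hi; g}` (as in `…QuantLawDEC`) -/
local notation3 "TP[" lo ", " hi ", " g ", " h "]" =>
  (g : ℝ) * (if (h : ℕ) = (hi : ℕ) then (1 : ℝ) else 0) + (1 - (g : ℝ)) * (if (h : ℕ) = (lo : ℕ) then (1 : ℝ) else 0)

namespace LawDec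

/-- the five-atom form of `Q` (as `mixLawQ_eq_atoms` of `…QuantGatedSliceMixLawQRouting`; restated to keep this file independent). -/
private theorem mixLawQ_eq_atoms' (z g lam : ℝ) (a k₁ k₂ : ℕ) (p : ℕ) :
    z * (if p = 0 then (1 : ℝ) else 0) + (1 - z) * slice (fun q => TP[k₁, k₂, lam, q]) a g p
      = z * (if p = 0 then (1 : ℝ) else 0) + (1 - z) * (1 - lam) * (1 - g) * (if p = k₁ then (1 : ℝ) else 0)
        + (1 - z) * (1 - lam) * g * (if p = k₁ + a then (1 : ℝ) else 0)
        + (1 - z) * lam * (1 - g) * (if p = k₂ then (1 : ℝ) else 0)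
        + (1 - z) * lam * g * (if p = k₂ + a then (1 : ℝ) else 0) := by
  rw [slice_TP]
  ring

/-- **THE EXPLICIT ROUTING THEOREM FOR `Q` WITH BOTH COPIES `k₁`, `k₁ + a` LOW.**  See the file header. [this work] -/
theorem mixLawQ_decAtT_of_routing_deep (y z g S lam : ℝ) (a j M k₁ k₂ : ℕ) (x₁K x₁G x₂K x₂G : ℝ)
    (hy0 : 0 < y) (hy1 : y < 1) (hz0 : 0 ≤ z) (hz1 : z < 1) (hg1 : g ≤ 1) (hyg : y ≤ (1 - z) * g) (ha : 1 ≤ a)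
    (hta : y * (M : ℝ) ≤ S) (hk : k₁ ≤ k₂) (hk₂M : k₂ ≤ M) (hlam0 : 0 ≤ lam) (hlam1 : lam ≤ 1)
    (hmean : (1 - z) * ((k₁ : ℝ) + ((k₂ : ℝ) - k₁) * lam) = S)
    -- regime: `k₁ ≥ 1` and `k₁ + a` are `t`-lows, `k₂` is not, `k₂ + a` is a giant
    (hk₁ : 1 ≤ k₁) (hPj : k₁ + a ≤ j) (hPlow : 2 * ((k₁ + a : ℕ) : ℝ) < S + (a : ℝ) * g * (1 - z))
    (hK : S + (a : ℝ) * g * (1 - z) ≤ 2 * (k₂ : ℝ) ∨ j < k₂)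
    (hG : j + 1 ≤ k₂ + a)
    -- the routing of the two nonzero lows
    (hx₁K0 : 0 ≤ x₁K) (hx₁G0 : 0 ≤ x₁G) (hx₂K0 : 0 ≤ x₂K) (hx₂G0 : 0 ≤ x₂G)
    (hsplit₁ : x₁K + x₁G = (1 - z) * (1 - lam) * (1 - g)) (hsplit₂ : x₂K + x₂G = (1 - z) * (1 - lam) * g)
    (hK₁comp : 0 < x₁K → (j + 1 ≤ k₂ ∨ S + (a : ℝ) * g * (1 - z) < (k₁ : ℝ) + (k₂ : ℝ)))
    (hK₂comp : 0 < x₂K → (j + 1 ≤ k₂ ∨ S + (a : ℝ) * g * (1 - z) < ((k₁ + a : ℕ) : ℝ) + (k₂ : ℝ)))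
    (hcapK : usage y (S + (a : ℝ) * g * (1 - z)) j k₁ k₂ * x₁K + usage y (S + (a : ℝ) * g * (1 - z)) j (k₁ + a) k₂ * x₂K
      ≤ (1 - z) * lam * (1 - g))
    (hcapG : usage y (S + (a : ℝ) * g * (1 - z)) j k₁ (k₂ + a) * x₁G + usage y (S + (a : ℝ) * g * (1 - z)) j (k₁ + a) (k₂ + a) * x₂G
      ≤ (1 - z) * lam * g)
    -- the zero fits the priced leftovers
    (hoffer : (S + (a : ℝ) * g * (1 - z)) * z ≤
        (if j + 1 ≤ k₂ then (S + (a : ℝ) * g * (1 - z)) * (1 - y) / y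
          else if S + (a : ℝ) * g * (1 - z) < (k₂ : ℝ) then (k₂ : ℝ) - (S + (a : ℝ) * g * (1 - z)) else 0)
          * ((1 - z) * lam * (1 - g)
              - (usage y (S + (a : ℝ) * g * (1 - z)) j k₁ k₂ * x₁K + usage y (S + (a : ℝ) * g * (1 - z)) j (k₁ + a) k₂ * x₂K))
        + (S + (a : ℝ) * g * (1 - z)) * (1 - y) / y
          * ((1 - z) * lam * g
              - (usage y (S + (a : ℝ) * g * (1 - z)) j k₁ (k₂ + a) * x₁G
                  + usage y (S + (a : ℝ) * g * (1 - z)) j (k₁ + a) (k₂ + a) * x₂G))) :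
    DECAtT y (S + (a : ℝ) * g * (1 - z)) j (M + a)
      (fun p => z * (if p = 0 then (1 : ℝ) else 0) + (1 - z) * slice (fun q => TP[k₁, k₂, lam, q]) a g p) := by
  classical
  set t : ℝ := S + (a : ℝ) * g * (1 - z) with ht
  set A : ℝ := (1 - z) * (1 - lam) * (1 - g) with hA
  set B : ℝ := (1 - z) * (1 - lam) * g with hB
  set C : ℝ := (1 - z) * lam * (1 - g) with hC
  set D : ℝ := (1 - z) * lam * g with hD
  have hg0 : 0 < g := by
    by_contra hc
    have : (1 - z) * g ≤ 0 := mul_nonpos_of_nonneg_of_nonpos (by linarith) (not_lt.1 hc)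
    linarith
  have h1z : 0 < 1 - z := by linarith
  have hA0 : 0 ≤ A := mul_nonneg (mul_nonneg h1z.le (by linarith)) (by linarith)
  have hB0 : 0 ≤ B := mul_nonneg (mul_nonneg h1z.le (by linarith)) hg0.le
  have hC0 : 0 ≤ C := mul_nonneg (mul_nonneg h1z.le hlam0) (by linarith)
  have hD0 : 0 ≤ D := mul_nonneg (mul_nonneg h1z.le hlam0) hg0.le
  have ha0 : (0 : ℝ) < a := by exact_mod_cast (Nat.lt_of_lt_of_le Nat.zero_lt_one ha)
  have hk₁r : (1 : ℝ) ≤ k₁ := by exact_mod_cast hk₁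
  have hkr : (k₁ : ℝ) ≤ k₂ := by exact_mod_cast hk
  have htpos : 0 < t := by
    have hd : 0 ≤ ((k₂ : ℝ) - k₁) * lam := mul_nonneg (by linarith) hlam0
    have hS' : (1 - z) * (k₁ : ℝ) ≤ S := by
      rw [← hmean]
      exact mul_le_mul_of_nonneg_left (by linarith) h1z.le
    have hpos : (0:ℝ) < (1 - z) * k₁ := mul_pos h1z (by linarith)
    have h2 : 0 ≤ (a : ℝ) * g * (1 - z) := mul_nonneg (mul_nonneg ha0.le hg0.le) h1z.le
    rw [ht]; linarith
  -- the low `k₁`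
  have hk₁j : k₁ ≤ j := by omega
  have hk₁low : 2 * (k₁ : ℝ) < t := by
    have : (k₁ : ℝ) ≤ ((k₁ + a : ℕ) : ℝ) := by exact_mod_cast Nat.le_add_right k₁ a
    linarith
  -- positions
  have hPK : k₁ + a ≠ k₂ := by
    intro hc
    rcases hK with h2 | h2
    · rw [← hc] at h2; linarith
    · omega
  have hk₁k₂ : k₁ < k₂ := by
    rcases Nat.eq_or_lt_of_le hk with heq | hlt
    · exfalso
      rcases hK with h2 | h2
      · rw [← heq] at h2; linarith
      · omega
    · exact hlt
  have hPne : k₁ + a ≠ k₁ := by omega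
  have hKne : k₂ ≠ k₁ := by omega
  have hGne : k₂ + a ≠ k₁ := by omega
  have hGneP : k₂ + a ≠ k₁ + a := by omega
  have hGneK : k₂ + a ≠ k₂ := by omega
  have hPN : k₁ + a < M + a + 1 := by omega
  have hKN : k₂ < M + a + 1 := by omega
  have hGN : k₂ + a < M + a + 1 := by omega
  -- the five-atom form (opaque name)
  obtain ⟨Q, hQdef⟩ : ∃ Q : ℕ → ℝ, ∀ p, Q p = z * (if p = 0 then (1 : ℝ) else 0) + A * (if p = k₁ then (1 : ℝ) else 0)
      + B * (if p = k₁ + a then (1 : ℝ) else 0) + C * (if p = k₂ then (1 : ℝ) else 0)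
      + D * (if p = k₂ + a then (1 : ℝ) else 0) := ⟨fun p => _, fun p => rfl⟩
  have hQp : ∀ p, z * (if p = 0 then (1 : ℝ) else 0) + (1 - z) * slice (fun q => TP[k₁, k₂, lam, q]) a g p = Q p := by
    intro p
    rw [hQdef, mixLawQ_eq_atoms']
  obtain ⟨q0', qM', q1', -⟩ := gateCell_laws z g lam a M k₁ k₂ hz0 hz1.le hg0.le hg1 hlam0 hlam1 (hk.trans hk₂M) hk₂M
  have q0 : ∀ h, 0 ≤ Q h := fun h => by rw [← hQp h]; exact q0' h
  have qM : ∀ h, M + a < h → Q h = 0 := fun h hh => by rw [← hQp h]; exact qM' h hh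
  have q1 : ∑ h ∈ Finset.range (M + a + 1), Q h = 1 := by
    rw [← q1']; exact Finset.sum_congr rfl fun h _ => (hQp h).symm
  -- values of `Q`
  have hQ0 : Q 0 = z := by
    rw [hQdef, if_pos rfl, if_neg (by omega : (0:ℕ) ≠ k₁), if_neg (by omega : (0:ℕ) ≠ k₁ + a),
      if_neg (by omega : (0:ℕ) ≠ k₂), if_neg (by omega : (0:ℕ) ≠ k₂ + a)]; ring
  have hQk₁ : Q k₁ = A := by
    rw [hQdef, if_neg (by omega : k₁ ≠ 0), if_pos rfl, if_neg (Ne.symm hPne), if_neg (Ne.symm hKne), if_neg (Ne.symm hGne)]; ring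
  have hQP : Q (k₁ + a) = B := by
    rw [hQdef, if_neg (by omega : k₁ + a ≠ 0), if_neg hPne, if_pos rfl, if_neg hPK, if_neg (Ne.symm hGneP)]; ring
  have hQK : Q k₂ = C := by
    rw [hQdef, if_neg (by omega : k₂ ≠ 0), if_neg hKne, if_neg (Ne.symm hPK), if_pos rfl, if_neg (Ne.symm hGneK)]; ring
  have hQG : Q (k₂ + a) = D := by
    rw [hQdef, if_neg (by omega : k₂ + a ≠ 0), if_neg hGne, if_neg hGneP, if_neg hGneK, if_pos rfl]; ring
  have hQoff : ∀ p, p ≠ 0 → p ≠ k₁ → p ≠ k₁ + a → p ≠ k₂ → p ≠ k₂ + a → Q p = 0 := by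
    intro p h0 h1 h2 h3 h4
    rw [hQdef, if_neg h0, if_neg h1, if_neg h2, if_neg h3, if_neg h4]; ring
  refine decAtT_congr (fun p => (hQp p).symm) ?_
  refine decAtT_of_flowAtT y t j (M + a) Q hy0 hy1 qM q1 ?_
  -- the routing (two charged rows; opaque name)
  obtain ⟨φ, hφdef⟩ : ∃ φ : ℕ → ℕ → ℝ, ∀ l h, φ l h =
      (if l = k₁ then ((if h = k₂ then x₁K else 0) + (if h = k₂ + a then x₁G else 0)) else 0)
      + (if l = k₁ + a then ((if h = k₂ then x₂K else 0) + (if h = k₂ + a then x₂G else 0)) else 0) :=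
    ⟨fun l h => _, fun l h => rfl⟩
  have hφ₁ : ∀ h, φ k₁ h = (if h = k₂ then x₁K else 0) + (if h = k₂ + a then x₁G else 0) := by
    intro h; rw [hφdef, if_pos rfl, if_neg (Ne.symm hPne)]; ring
  have hφ₂ : ∀ h, φ (k₁ + a) h = (if h = k₂ then x₂K else 0) + (if h = k₂ + a then x₂G else 0) := by
    intro h; rw [hφdef, if_neg hPne, if_pos rfl]; ring
  have hφne : ∀ l h, l ≠ k₁ → l ≠ k₁ + a → φ l h = 0 := by
    intro l h hl1 hl2; rw [hφdef, if_neg hl1, if_neg hl2]; ring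
  have hφ₁K : φ k₁ k₂ = x₁K := by rw [hφ₁, if_pos rfl, if_neg (Ne.symm hGneK)]; ring
  have hφ₁G : φ k₁ (k₂ + a) = x₁G := by rw [hφ₁, if_neg hGneK, if_pos rfl]; ring
  have hφ₂K : φ (k₁ + a) k₂ = x₂K := by rw [hφ₂, if_pos rfl, if_neg (Ne.symm hGneK)]; ring
  have hφ₂G : φ (k₁ + a) (k₂ + a) = x₂G := by rw [hφ₂, if_neg hGneK, if_pos rfl]; ring
  have hφ₁off : ∀ h, h ≠ k₂ → h ≠ k₂ + a → φ k₁ h = 0 := by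
    intro h h2 h3; rw [hφ₁, if_neg h2, if_neg h3]; ring
  have hφ₂off : ∀ h, h ≠ k₂ → h ≠ k₂ + a → φ (k₁ + a) h = 0 := by
    intro h h2 h3; rw [hφ₂, if_neg h2, if_neg h3]; ring
  have hφ0 : ∀ l h, 0 ≤ φ l h := by
    intro l h
    by_cases hl1 : l = k₁
    · rw [hl1, hφ₁]
      refine add_nonneg ?_ ?_ <;> split_ifs <;> first | exact le_rfl | assumption
    · by_cases hl2 : l = k₁ + a
      · rw [hl2, hφ₂]
        refine add_nonneg ?_ ?_ <;> split_ifs <;> first | exact le_rfl | assumption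
      · rw [hφne l h hl1 hl2]
  -- top-affordability of the mids above `t`
  have htaM : ∀ h : ℕ, h ≤ j → h ≤ M + a → t < (h : ℝ) → y * (h : ℝ) ≤ t := by
    intro h _ hhM _
    have hh : (h : ℝ) ≤ (M : ℝ) + a := by exact_mod_cast hhM
    have h1 : y * (h : ℝ) ≤ y * (M : ℝ) + y * a := by
      calc y * (h : ℝ) ≤ y * ((M : ℝ) + a) := mul_le_mul_of_nonneg_left hh hy0.le
        _ = y * (M : ℝ) + y * a := by ring
    have h3 : y * (a : ℝ) ≤ (a : ℝ) * g * (1 - z) := by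
      calc y * (a : ℝ) ≤ (1 - z) * g * (a : ℝ) := mul_le_mul_of_nonneg_right hyg (Nat.cast_nonneg a)
        _ = (a : ℝ) * g * (1 - z) := by ring
    rw [ht]; linarith
  -- column loads: the two charged rows
  have hload : ∀ h, ∑ l ∈ Finset.range (j + 1), usage y t j l h * φ l h
      = usage y t j k₁ h * φ k₁ h + usage y t j (k₁ + a) h * φ (k₁ + a) h := by
    intro h
    have e : ∀ l ∈ Finset.range (j + 1), usage y t j l h * φ l h
        = (if l = k₁ then usage y t j k₁ h * φ k₁ h else 0) + (if l = k₁ + a then usage y t j (k₁ + a) h * φ (k₁ + a) h else 0) := by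
      intro l _
      by_cases hl1 : l = k₁
      · subst hl1; rw [if_pos rfl, if_neg (Ne.symm hPne)]; ring
      · by_cases hl2 : l = k₁ + a
        · subst hl2; rw [if_neg hPne, if_pos rfl]; ring
        · rw [if_neg hl1, if_neg hl2, hφne l h hl1 hl2]; ring
    rw [Finset.sum_congr rfl e, Finset.sum_add_distrib, Finset.sum_ite_eq' (Finset.range (j + 1)) k₁,
      Finset.sum_ite_eq' (Finset.range (j + 1)) (k₁ + a), if_pos (Finset.mem_range.2 (Nat.lt_succ_of_le hk₁j)),
      if_pos (Finset.mem_range.2 (Nat.lt_succ_of_le hPj))]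
  refine flowAtT_of_offers y t j (M + a) Q φ hy0 hy1 htpos q0 htaM hφ0 ?_ ?_ ?_ ?_
  · -- support of the routing
    intro l h hp
    by_cases hl1 : l = k₁
    · subst hl1
      refine ⟨⟨hk₁, hk₁j, hk₁low⟩, ?_⟩
      by_cases h2 : h = k₂
      · subst h2; rw [hφ₁K] at hp; exact ⟨by omega, hK₁comp hp⟩
      · by_cases h3 : h = k₂ + a
        · subst h3; exact ⟨by omega, Or.inl hG⟩
        · rw [hφ₁off h h2 h3] at hp; exact absurd hp (lt_irrefl _)
    · by_cases hl2 : l = k₁ + a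
      · subst hl2
        refine ⟨⟨by omega, hPj, hPlow⟩, ?_⟩
        by_cases h2 : h = k₂
        · subst h2; rw [hφ₂K] at hp; exact ⟨by omega, hK₂comp hp⟩
        · by_cases h3 : h = k₂ + a
          · subst h3; exact ⟨by omega, Or.inl hG⟩
          · rw [hφ₂off h h2 h3] at hp; exact absurd hp (lt_irrefl _)
      · rw [hφne l h hl1 hl2] at hp; exact absurd hp (lt_irrefl _)
  · -- rows
    intro l hl1 hlj hlow
    by_cases hla : l = k₁
    · subst hla
      rw [Finset.sum_congr rfl (fun h _ => hφ₁ h), Finset.sum_add_distrib,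
        Finset.sum_ite_eq' (Finset.range (M + a + 1)) k₂, Finset.sum_ite_eq' (Finset.range (M + a + 1)) (k₂ + a),
        if_pos (Finset.mem_range.2 hKN), if_pos (Finset.mem_range.2 hGN), hQk₁, hsplit₁]
    · by_cases hlb : l = k₁ + a
      · subst hlb
        rw [Finset.sum_congr rfl (fun h _ => hφ₂ h), Finset.sum_add_distrib,
          Finset.sum_ite_eq' (Finset.range (M + a + 1)) k₂, Finset.sum_ite_eq' (Finset.range (M + a + 1)) (k₂ + a),
          if_pos (Finset.mem_range.2 hKN), if_pos (Finset.mem_range.2 hGN), hQP, hsplit₂]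
      · rw [Finset.sum_eq_zero (fun h _ => hφne l h hla hlb)]
        have hlK : l ≠ k₂ := by
          rintro rfl
          rcases hK with h2 | h2
          · linarith
          · omega
        rw [hQoff l (by omega) hla hlb hlK (by omega)]
  · -- columns
    intro h hhM habs
    rw [hload h]
    by_cases h2 : h = k₂
    · subst h2; rw [hφ₁K, hφ₂K, hQK]; exact hcapK
    · by_cases h3 : h = k₂ + a
      · subst h3; rw [hφ₁G, hφ₂G, hQG]; exact hcapG
      · rw [hφ₁off h h2 h3, hφ₂off h h2 h3, mul_zero, mul_zero, add_zero]
        exact q0 h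
  · -- the zero's offer inequality
    rw [hQ0]
    have e : ∀ h ∈ Finset.range (M + a + 1),
        (if j + 1 ≤ h then t * (1 - y) / y else if t < (h : ℝ) then (h : ℝ) - t else 0)
          * (Q h - ∑ l ∈ Finset.range (j + 1), usage y t j l h * φ l h)
        = (if h = k₂ then
            (if j + 1 ≤ k₂ then t * (1 - y) / y else if t < (k₂ : ℝ) then (k₂ : ℝ) - t else 0)
              * (C - (usage y t j k₁ k₂ * x₁K + usage y t j (k₁ + a) k₂ * x₂K)) else 0)
          + (if h = k₂ + a then t * (1 - y) / y
              * (D - (usage y t j k₁ (k₂ + a) * x₁G + usage y t j (k₁ + a) (k₂ + a) * x₂G)) else 0) := by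
      intro h _
      rw [hload h]
      by_cases h2 : h = k₂
      · subst h2
        rw [hQK, hφ₁K, hφ₂K, if_pos rfl, if_neg (Ne.symm hGneK)]; ring
      · rw [if_neg h2]
        by_cases h3 : h = k₂ + a
        · subst h3
          rw [hQG, hφ₁G, hφ₂G, if_pos rfl, if_pos hG]; ring
        · rw [if_neg h3, hφ₁off h h2 h3, hφ₂off h h2 h3, mul_zero, mul_zero, add_zero, sub_zero]
          by_cases h0 : h = 0
          · subst h0; rw [hQ0, if_neg (by omega)]; push_cast; rw [if_neg (not_lt.2 htpos.le)]; ring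
          · by_cases h4 : h = k₁
            · subst h4; rw [hQk₁, if_neg (by omega), if_neg (by linarith)]; ring
            · by_cases h5 : h = k₁ + a
              · subst h5; rw [hQP, if_neg (by omega), if_neg (by linarith)]; ring
              · rw [hQoff h h0 h4 h5 h2 h3]; ring
    rw [Finset.sum_congr rfl e, Finset.sum_add_distrib,
      Finset.sum_ite_eq' (Finset.range (M + a + 1)) k₂, Finset.sum_ite_eq' (Finset.range (M + a + 1)) (k₂ + a),
      if_pos (Finset.mem_range.2 hKN), if_pos (Finset.mem_range.2 hGN)]
    exact hoffer

/-- **`GatedSliceMixLaw'` in the deep-shifted-copy classes from a routing (θ = 0).** [this work] -/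
theorem gatedSliceMixLaw'_of_routing_deep (y z g S lam : ℝ) (a j M h k₁ k₂ : ℕ) (x₁K x₁G x₂K x₂G : ℝ)
    (hy0 : 0 < y) (hy1 : y < 1) (hz0 : 0 ≤ z) (hz1 : z < 1) (hg1 : g ≤ 1) (hyg : y ≤ (1 - z) * g) (ha : 1 ≤ a)
    (hta : y * (M : ℝ) ≤ S) (hk : k₁ ≤ k₂) (hk₂M : k₂ ≤ M) (hlam0 : 0 ≤ lam) (hlam1 : lam ≤ 1)
    (hmean : (1 - z) * ((k₁ : ℝ) + ((k₂ : ℝ) - k₁) * lam) = S)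
    (hk₁ : 1 ≤ k₁) (hPj : k₁ + a ≤ j) (hPlow : 2 * ((k₁ + a : ℕ) : ℝ) < S + (a : ℝ) * g * (1 - z))
    (hK : S + (a : ℝ) * g * (1 - z) ≤ 2 * (k₂ : ℝ) ∨ j < k₂)
    (hG : j + 1 ≤ k₂ + a)
    (hx₁K0 : 0 ≤ x₁K) (hx₁G0 : 0 ≤ x₁G) (hx₂K0 : 0 ≤ x₂K) (hx₂G0 : 0 ≤ x₂G)
    (hsplit₁ : x₁K + x₁G = (1 - z) * (1 - lam) * (1 - g)) (hsplit₂ : x₂K + x₂G = (1 - z) * (1 - lam) * g)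
    (hK₁comp : 0 < x₁K → (j + 1 ≤ k₂ ∨ S + (a : ℝ) * g * (1 - z) < (k₁ : ℝ) + (k₂ : ℝ)))
    (hK₂comp : 0 < x₂K → (j + 1 ≤ k₂ ∨ S + (a : ℝ) * g * (1 - z) < ((k₁ + a : ℕ) : ℝ) + (k₂ : ℝ)))
    (hcapK : usage y (S + (a : ℝ) * g * (1 - z)) j k₁ k₂ * x₁K + usage y (S + (a : ℝ) * g * (1 - z)) j (k₁ + a) k₂ * x₂K
      ≤ (1 - z) * lam * (1 - g))
    (hcapG : usage y (S + (a : ℝ) * g * (1 - z)) j k₁ (k₂ + a) * x₁G + usage y (S + (a : ℝ) * g * (1 - z)) j (k₁ + a) (k₂ + a) * x₂G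
      ≤ (1 - z) * lam * g)
    (hoffer : (S + (a : ℝ) * g * (1 - z)) * z ≤
        (if j + 1 ≤ k₂ then (S + (a : ℝ) * g * (1 - z)) * (1 - y) / y
          else if S + (a : ℝ) * g * (1 - z) < (k₂ : ℝ) then (k₂ : ℝ) - (S + (a : ℝ) * g * (1 - z)) else 0)
          * ((1 - z) * lam * (1 - g)
              - (usage y (S + (a : ℝ) * g * (1 - z)) j k₁ k₂ * x₁K + usage y (S + (a : ℝ) * g * (1 - z)) j (k₁ + a) k₂ * x₂K))
        + (S + (a : ℝ) * g * (1 - z)) * (1 - y) / y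
          * ((1 - z) * lam * g
              - (usage y (S + (a : ℝ) * g * (1 - z)) j k₁ (k₂ + a) * x₁G
                  + usage y (S + (a : ℝ) * g * (1 - z)) j (k₁ + a) (k₂ + a) * x₂G))) :
    ∃ θ : ℝ, 0 ≤ θ ∧ θ < 1 ∧
      DECAtT y (S + (a : ℝ) * g * (1 - z)) j (M + a)
        (fun p => θ * weakMidLaw S g h a p
          + (1 - θ) * (z * (if p = 0 then (1 : ℝ) else 0) + (1 - z) * slice (fun q => TP[k₁, k₂, lam, q]) a g p)) := by
  refine ⟨0, le_rfl, zero_lt_one, ?_⟩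
  refine decAtT_congr (fun p => ?_)
    (mixLawQ_decAtT_of_routing_deep y z g S lam a j M k₁ k₂ x₁K x₁G x₂K x₂G hy0 hy1 hz0 hz1 hg1 hyg ha hta hk hk₂M hlam0 hlam1
      hmean hk₁ hPj hPlow hK hG hx₁K0 hx₁G0 hx₂K0 hx₂G0 hsplit₁ hsplit₂ hK₁comp hK₂comp hcapK hcapG hoffer)
  ring

end LawDec

end Quant

end Summit.CriticalPhenomena.PercolationContinuityZ3.Theorems
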